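import Summits.BirchSwinnertonDyer.BirchSwinnertonDyer.Theorems.KatoDescentTamePotSupersingularCartanMuRoadDoorsTprimeFive
import Literature.NumberTheory.EllipticCurves.FineSelmerRankEqualitySplitCartanFive
import Literature.NumberTheory.EllipticCurves.FineSelmerRankEqualitySplitCartanFiveIndexTwo
import HarnessLib

/-!
# Route `KatoDescentTamePotSupersingular` (rung K8, sub-rung B4 (t′), cell `bsd-potss`): U₀ DOORS at the `5Ns` rows FROM THE LAYER-0 RANK EQUALITY
# `rank_5 Cl(ℚ(P)) = rank_5 Cl(ℚ(x(P)))` (degrees `8` and `4`, certifiable) — full `C_s⁺(5)` image and the index-`2` image `G₁₆ ≅ M₁₆`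

Seat `bsd-potss-k8t-c4` g26; `--supports stmt-BirchSwinnertonDyer-19982 --as helper`. THEOREMS ONLY (no definition, no named fact, no `sorry`);
nothing booked; (A), Conjecture A and BSD are proved for NO curve here; items 19202 / 19982 stay OPEN at class level (open inputs class-wide: zeta
crux 24439, lower half of 19984).

The 76 KT U₀-ns (t′) rank-`0` rows with mod-`5` image in the normaliser of a split Cartan subgroup (`5Ns`) carry, in the tree, ONLY unit-twist records
(`TameUpperUnitTwistRecords`: the rank-one Heegner twist's BSD inputs displayed) except four `μ`-road rows.  The rank-equality road (k8t-c4 g25, image-agnostic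
form `CoatesSujatha2005.RankEqualityRoad.conjA_of_rankEq`) gives them a Kato-(A) road whose per-row input is the equality of two CERTIFIABLE class-group
`5`-ranks at layer 0 — `ℚ(P)` (degree `8`) and `ℚ(x(P))` (degree `4`) for an axis point `P` — instead of classical-`μ` hypotheses:

§1 `missingUpperBoundAt_five_tame_of_splitCartanBasis_of_rankEq` — full `C_s⁺(5)` image (tree basis data `σ_u ↦ diag(2,1)`, `σ_v ↦ diag(1,2)`,
   `σ_w ↦ (0 1; 1 0)`): U₀ modulo `hKatoA hGZK hmod` from `hrank` and the DISPLAYED inertia input `hcI : σ̄_u²σ̄_v² (= −1) ∈ I(𝔮|5)` (a ramification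
   datum of `ℚ(E[5])/ℚ(x(E[5]))` above `5`; for additive potentially supersingular rows it holds by the structure of tame inertia, not in the tree);
§2 `missingUpperBoundAt_five_tame_of_splitCartanIndexTwoBasis_of_rankEq` — index-`2` image `G₁₆` (tree shape: `d = ±a`, `c ∈ {2b,3b}`; `σ_s ↦ diag(1,4)`,
   `σ_a ↦ (0 1; 2 0)`): U₀ modulo `hKatoA hGZK hmod` from `hrank` ALONE — the inertia input is automatic (k8t-c4 g26,
   `conjA_five_of_splitCartanIndexTwoBasis_of_rankEq`: every element of `G₁₆` of determinant `2` has fourth power `−1`, and `det ρ̄(I(𝔮|5)) = 𝔽₅ˣ`).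
Census (kit j333447, PARI 2.17, all class numbers `bnfcertify`d): 58 rows have `#Gal(ℚ(E[5])/ℚ) = 32` (SmallGroup `[32,11]`), 18 have `16` (`[16,6] = M₁₆`);
`rank_5 Cl(ℚ(P)) = rank_5 Cl(ℚ(x(P))) = 0` on 74 rows, FAILS on `235200xb1` (`h(ℚ(P)) = 80`) and `338800ex1` (`160`); every prime of `ℚ(x(E[5]))` above `5`
ramifies in `ℚ(E[5])` on all 76 (`hcI` numerically).  Records: `…TameUpperRankEqRecordsSplit01…`.  CONDITIONAL; per row; nothing booked; BSD for no curve.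

References: [Kato2004Asterisque] Thm. 14.5 (3); [CoatesSujatha2005] Thm. 3.4; [Iwasawa1956]; [Serre1972] §2.2, §5.2 (iii); [Cremona2006] Table 1.
-/

set_option autoImplicit false
-- the Theorems directory repeats the summit name (`Summits/BirchSwinnertonDyer/BirchSwinnertonDyer/…`): house rule of the cell
set_option linter.dupNamespace false

noncomputable section

open scoped Classical NumberField Matrix
open WeierstrassCurve Field IntermediateField
  Literature.NumberTheory.EllipticCurves Literature.NumberTheory.EllipticCurves.Rank1Residual
  Literature.NumberTheory.EllipticCurves.Rank1Residual.Typed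
  Literature.NumberTheory.GaloisRepresentations Literature.NumberTheory.SerreUniformity
  Literature.NumberTheory.IwasawaTheory
  Literature.NumberTheory.EllipticCurves.CoatesSujatha2005.RankEqualityRoad
  Summit.BirchSwinnertonDyer.Rank1Residual Summit.BirchSwinnertonDyer.Rank1Residual.Additive
  Summit.BirchSwinnertonDyer.BirchSwinnertonDyer.Theorems

namespace Summit.BirchSwinnertonDyer.BirchSwinnertonDyer.Theorems.TameRankEqRecords

/-! ### §1 Full `C_s⁺(5)` image: U₀ from the rank equality + displayed inertia input -/

/-- **U₀ `MissingUpperBoundAt E 5` at a rank-`0` (t′) row with image `C_s⁺(5)` FROM THE RANK EQUALITY** — the named facts `hKatoA hGZK hmod`, Cremona's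
`r_an = 0`, `Addv E 5`, `SubTprime E 5`, `E[5]` irreducible, the `C_s⁺(5)` basis data (`e he σu σv σw hσu hσv hσw`, displayed), the class-group datum
`hrank : #Cl(ℚ(E[5])^⟨σ̄_v⟩)[5] = #Cl(ℚ(E[5])^⟨σ̄_u²σ̄_v², σ̄_v⟩)[5]` (`ℚ(P)`, degree 8, vs `ℚ(x(P))`, degree 4) and the inertia input `hcI : σ̄_u²σ̄_v² ∈ I(𝔮)`
for every prime `𝔮 ∋ 5` of `ℚ(E[5])` (displayed).  NO `μ`-hypothesis.  `conjA_five_of_splitCartanBasis_of_rankEq` ∘ `CartanMuRoadDoorsTprimeFive.missingUpperBoundAt_tame_of_conjA`.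
CONDITIONAL; nothing booked; BSD for no curve. [cite: Kato2004Asterisque, Thm. 14.5 (3) (p. 236)] [cite: CoatesSujatha2005, §3 Thm. 3.4]
[cite: Iwasawa1956, §§3–5] [cite: Serre1972, §2.2] -/
theorem missingUpperBoundAt_five_tame_of_splitCartanBasis_of_rankEq (W : WeierstrassCurve ℚ) [W.IsElliptic] [W.IsGloballyMinimal]
    (hKatoA : Kato2004.rankZero_padicValNat_sha_add_padicValNat_tamagawa_le_of_additive_potGood_of_irreducible_of_fineSelmerDual_fg)
    (hGZK : rank_eq_analyticRank_of_analyticRank_le_one) (hmod : hasEntireLFunction_rat)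
    (hr : W.analyticRank = 0) (hadd : haveI : Fact (Nat.Prime 5) := ⟨by norm_num⟩; Addv W 5)
    (hT : haveI : Fact (Nat.Prime 5) := ⟨by norm_num⟩; SubTprime W 5)
    (hirr : haveI : Fact (Nat.Prime 5) := ⟨by norm_num⟩; W.HasIrreducibleModPGaloisRep 5)
    (e : W.geomTorsion (5 : ℕ) ≃+ (Fin 2 → ZMod 5))
    (he : ∀ σ : absoluteGaloisGroup ℚ, ∃ M ∈ splitCartanNormalizer 5, ∀ P : W.geomTorsion (5 : ℕ), e (σ • P) = M *ᵥ e P)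
    (σu σv σw : absoluteGaloisGroup ℚ) (hσu : ∀ P : W.geomTorsion (5 : ℕ), e (σu • P) = !![2, 0; 0, 1] *ᵥ e P)
    (hσv : ∀ P : W.geomTorsion (5 : ℕ), e (σv • P) = !![1, 0; 0, 2] *ᵥ e P)
    (hσw : ∀ P : W.geomTorsion (5 : ℕ), e (σw • P) = !![0, 1; 1, 0] *ᵥ e P)
    (hrank : Nat.card {d : ClassGroup (𝓞 ↥(fixedField (Subgroup.zpowers (absRestrictNormalHom (W.divisionField 5) σv)))) // d ^ 5 = 1} =
      Nat.card {d : ClassGroup (𝓞 ↥(fixedField (Subgroup.zpowers (absRestrictNormalHom (W.divisionField 5) (σu * σu * (σv * σv))) ⊔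
        Subgroup.zpowers (absRestrictNormalHom (W.divisionField 5) σv)))) // d ^ 5 = 1})
    (hcI : ∀ (𝔮 : Ideal (𝓞 ↥(W.divisionField 5))) [𝔮.IsMaximal], ((5 : ℕ) : 𝓞 ↥(W.divisionField 5)) ∈ 𝔮 →
      absRestrictNormalHom (W.divisionField 5) (σu * σu * (σv * σv)) ∈ 𝔮.inertia _) :
    haveI : Fact (Nat.Prime 5) := ⟨by norm_num⟩
    MissingUpperBoundAt W 5 := by
  haveI : Fact (Nat.Prime 5) := ⟨by norm_num⟩
  exact CartanMuRoadDoorsTprimeFive.missingUpperBoundAt_tame_of_conjA W hKatoA hGZK hmod 5 hr (by decide) hadd hT hirr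
    (conjA_five_of_splitCartanBasis_of_rankEq W e he σu σv σw hσu hσv hσw hrank hcI)

/-! ### §2 Index-`2` image `G₁₆ ≅ M₁₆`: U₀ from the rank equality alone -/

/-- **U₀ `MissingUpperBoundAt E 5` at a rank-`0` (t′) row with image `G₁₆` FROM THE RANK EQUALITY ALONE** — the named facts `hKatoA hGZK hmod`, Cremona's
`r_an = 0`, `Addv E 5`, `SubTprime E 5`, `E[5]` irreducible, the `G₁₆` basis data (`e he σs σa hσs hσa`, displayed: the tree's index-two shape) and the
class-group datum `hrank : #Cl(ℚ(E[5])^⟨σ̄_s⟩)[5] = #Cl(ℚ(E[5])^⟨σ̄_a⁴, σ̄_s⟩)[5]` (`ℚ(P)`, degree 8, vs `ℚ(x(P))`, degree 4).  NO `μ`-hypothesis, NO inertia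
hypothesis (automatic: `conjA_five_of_splitCartanIndexTwoBasis_of_rankEq`).  CONDITIONAL; nothing booked; BSD for no curve.
[cite: Kato2004Asterisque, Thm. 14.5 (3) (p. 236)] [cite: CoatesSujatha2005, §3 Thm. 3.4] [cite: Iwasawa1956, §§3–5] [cite: Serre1972, §2.2 and §5.2 (iii)] -/
theorem missingUpperBoundAt_five_tame_of_splitCartanIndexTwoBasis_of_rankEq (W : WeierstrassCurve ℚ) [W.IsElliptic] [W.IsGloballyMinimal]
    (hKatoA : Kato2004.rankZero_padicValNat_sha_add_padicValNat_tamagawa_le_of_additive_potGood_of_irreducible_of_fineSelmerDual_fg)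
    (hGZK : rank_eq_analyticRank_of_analyticRank_le_one) (hmod : hasEntireLFunction_rat)
    (hr : W.analyticRank = 0) (hadd : haveI : Fact (Nat.Prime 5) := ⟨by norm_num⟩; Addv W 5)
    (hT : haveI : Fact (Nat.Prime 5) := ⟨by norm_num⟩; SubTprime W 5)
    (hirr : haveI : Fact (Nat.Prime 5) := ⟨by norm_num⟩; W.HasIrreducibleModPGaloisRep 5)
    (e : W.geomTorsion (5 : ℕ) ≃+ (Fin 2 → ZMod 5))
    (he : ∀ σ : absoluteGaloisGroup ℚ, ∃ M ∈ splitCartanNormalizer 5, (M 1 1 = M 0 0 ∨ M 1 1 = 4 * M 0 0) ∧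
      (M 1 0 = 2 * M 0 1 ∨ M 1 0 = 3 * M 0 1) ∧ ∀ P : W.geomTorsion (5 : ℕ), e (σ • P) = M *ᵥ e P)
    (σs σa : absoluteGaloisGroup ℚ) (hσs : ∀ P : W.geomTorsion (5 : ℕ), e (σs • P) = !![1, 0; 0, 4] *ᵥ e P)
    (hσa : ∀ P : W.geomTorsion (5 : ℕ), e (σa • P) = !![0, 1; 2, 0] *ᵥ e P)
    (hrank : Nat.card {d : ClassGroup (𝓞 ↥(fixedField (Subgroup.zpowers (absRestrictNormalHom (W.divisionField 5) σs)))) // d ^ 5 = 1} =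
      Nat.card {d : ClassGroup (𝓞 ↥(fixedField (Subgroup.zpowers (absRestrictNormalHom (W.divisionField 5) (σa ^ 4)) ⊔
        Subgroup.zpowers (absRestrictNormalHom (W.divisionField 5) σs)))) // d ^ 5 = 1}) :
    haveI : Fact (Nat.Prime 5) := ⟨by norm_num⟩
    MissingUpperBoundAt W 5 := by
  haveI : Fact (Nat.Prime 5) := ⟨by norm_num⟩
  exact CartanMuRoadDoorsTprimeFive.missingUpperBoundAt_tame_of_conjA W hKatoA hGZK hmod 5 hr (by decide) hadd hT hirr
    (conjA_five_of_splitCartanIndexTwoBasis_of_rankEq W e he σs σa hσs hσa hrank)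

end Summit.BirchSwinnertonDyer.BirchSwinnertonDyer.Theorems.TameRankEqRecords

end
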